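import Literature.MathematicalPhysics.QuantumFieldTheory.Balaban1983to89.B5HierGaugeTorus
import Literature.MathematicalPhysics.QuantumFieldTheory.Balaban1983to89.B5ChangeOfGauge123
import Literature.MathematicalPhysics.QuantumFieldTheory.Balaban1983to89.B5GaussSectC
import Literature.MathematicalPhysics.QuantumFieldTheory.Balaban1983to89.B5Eq114Gauss

/-!
# `Balaban1983to89.B5Eq123Torus` — T. Bałaban, *Propagators and renormalization transformations for lattice gauge
theories. I*, Commun. Math. Phys. **95** (1984) 17–40 [Balaban1984PropagatorsI], Sect. C p. 21 [PDF 5]: the Faddeev–Popov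
identity (1.22) and the change of gauge (1.23) PROVED on every level `k` of the tower for the typed objects of
`B5SectBStatements` (`fp22`, `Claim122`, `rt17`, `rt23`, `Eq123` on the concrete torus carrier)

statement-level skeleton of published theorems with citation tags; proofs where landed; nothing here is a claim about the Yang–Mills mass gap

PDF held: `paper:balaban1984-cmp95-propagators-rt-i` ((1.22)–(1.24) are p. 21 = PDF p. 5, read as an image on the page render
`run/shared/lean/pub/pub-balaban/b2b-balaban-ref1/pages/1984-cmp95-propagators-rt-I/…-p005-x2.png`; p. 25 from the
materialised text).

WHAT IS REPRODUCED.  SKELETON row `B5.Eq1.23` ((1.22)–(1.23)), Phase-2 seat p37 (gen 2).  Roles for this row (lead ruling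
G.5-38; B5 owner r02 g2, 2026-08-21T01:10:24Z): the TYPED STATEMENT of record is `B5SectBStatements.Claim122 / Eq123`
(r02; the literal `(ST)^k`, `Q_k`, `Q′_k`, `δ`-integrals over the tower of tori `towerM`), the MECHANISM of record is
`B5ChangeOfGauge123.eq123` (p22; «we change the order of integrations … we make the gauge transformation −λ′ … we change the
order of integrations again and we make a translation λ → λ + λ′», proved over abstract carriers with the slice ⊕ orbit
coordinates as DATA), and THIS FILE is the CONCRETE INSTANCE: it constructs that data for the typed objects on every
level `k` (from the hierarchical gauge of `B5HierGaugeTorus`) and discharges every hypothesis of the mechanism, so that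

* `claim122 : ∀ k, 0 < α → Claim122 L M k α` — (1.22) «we will see that it is different from 0»: the Faddeev–Popov
  integral `∫dλ δ(Q′_kλ) exp(−(1/2α)⟨∂*A^λ, ∂*A^λ⟩)` is `> 0` for every real field (§2: it is the Gaussian integral (1.24)
  of `B5GaussSectC` over `N(Q′_k)`, and «Δ is positive definite on N(Q′_k)» (p. 25) is PROVED for the composite `Q′_k`:
  `injOn_LapR_resid`, from the tree's `B5LaplaceSpectral.LapS_ker_const`);
* `rt17_eq_rt23 : ∀ k, 0 < α → ∃ c > 0, ∀ B, rt17 L M k B = c · rt23 L M k α B` — (1.23): the axial `δ`-functions of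
  (1.17) are traded for the Faddeev–Popov weight at the cost of ONE numerical factor (`z^{(k)} → z′^{(k)} = z^{(k)}·c`,
  `c` = the Jacobian of the coordinates, `B5ChangeOfGauge123.jacobian_pos`);
* `eq123_holds_of_eq117 : ∀ k, Eq117 L M k → Eq123 L M k` and, with the B5 owner's (1.17) (`B5Eq114Gauss.eq117_holds`,
  `eq117_one`), **`eq123_holds : 2 ≤ d → ∀ k, Eq123 L M k`** and **`eq123_one : Eq123 L M 1`** (any `d`) — (1.23) for
  `(ST)^k e^{−S}` itself, the typed CLAIM of record DISCHARGED (bookkeeping `B5SectBStatements.eq123_of_eq117`);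
  `claim122_one` is the level-1 case of `claim122`.

ARCHITECTURE.  §1 on level `k`: the slice directions `{Q_km = 0, m in the support of δ_Ax(Q_{k−1}·)…δ_Ax(·)}`, the residual
gauge group `N(Q′_k)`, the fibre directions `{Q_kn = 0}`, and the coordinates `coords k : (m, λ) ↦ m − ∂^{L^k}λ`, a
continuous linear BIJECTION — injective = uniqueness, surjective = existence of the hierarchical gauge
(`B5HierGaugeTorus.hierGauge_unique/exists`), into the fibre directions by «Q_k∂^{L^k}λ = ∂Q′_kλ = 0» (`Qk_Dg_eq_zero`).
§2 (1.22) ⟸ (1.24): `⟨∂*A^λ, ∂*A^λ⟩ = η^d‖∂*A − Δλ‖²` (`divSq_gaugeR`; `∂*(A^λ) = ∂*A − Δλ` from `(∂)^*∂ = Δ`,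
`B5Action121`), `fp22 k α A = ∫_{N(Q′_k)} γ_{α/η^d}(∂*A − Δλ)dλ = Z_N·γ(∂*A − R∂*A) > 0` (`B5GaussSectC.integral_124`,
`ZN_pos`; injectivity of `Δ` on `N(Q′_k)`: `Δλ = 0 ⟹ λ` constant, `Q′_k` of a constant is that constant, `Qsk_constScl`).  §3
(1.23): `B5ChangeOfGauge123.eq123` with `M₀, Λ, N` = slice / `N(Q′_k)` / fibre directions under their Lebesgue measures
(r02's `deltaInt`, base-point independence `deltaInt_eq`), `e = coords k`, `ρ = e^{−S^η}` gauge invariant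
(`B5HierGaugeTorus.actionEta_gaugeR`), `hZ` = §2, measurability by continuity (`continuous_divSq`, `continuous_actionEta`);
the fibre of (1.17) is non-empty on every level (iterate r02's section `secFld`, `fibre_slice_nonempty`).

NOT CERTIFIED HERE: the value of `c` (the paper does not compute it either: «z′^{(k)}» is a numerical factor), (1.17) itself
(r02's companion file), anything of (1.24)–(1.28) beyond the use of `B5GaussSectC` by name.  Helper facts of linear algebra /
measure theory carry the cite of the display they serve; nothing of the series is restated.

Unit `lit-balaban-p37` gen 2 (Phase-2 proof seat p37; literature-prover-lit-balaban-p37-g2-0), HOME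
`run/shared/lean/pub/lit-balaban/` (STATUS: `lit-balaban-p37/STATUS.md`), 2026-08-21.  Complement of p243885
(`B5ChangeOfGauge123`, mechanism) and of p243630 (`B5SectBStatements`, statements); companions `B5Eq123FaddeevPopov`
(p243942/p244042) and `B5Eq123Constants` (p243943/p244043) give the same passage for `ℝ≥0∞`-weights over abstract carriers.
-/

namespace Literature.MathematicalPhysics.QuantumFieldTheory.Balaban1983to89.B5Eq123Torus

open B5SectBStatements B5HierGaugeTorus
open B5Prop11Plancherel (Tor fine unitVec)
open B5Block118 (bpt tstep up iota)
open Beta.FluctuationProjection (digitOf digitOf_bpt bpt_blockOf_digitOf bpt_add_tstep_of_lt)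
open scoped Matrix

noncomputable section

variable {d : ℕ}

/-! ## §1  Level `k`: the slice ⊕ orbit coordinates `(m, λ) ↦ m − ∂^{L^k}λ` of the fibre directions `{Q_k· = 0}` -/

section CoordsK

variable (L : ℕ) (M : Fin d → ℕ) [NeZero L] [hM : ∀ μ, NeZero (M μ)]

/-- the slice directions on level `k`: `{m : Q_km = 0, m ∈ support of δ_Ax(Q_{k−1}·)…δ_Ax(·)}` — the domain of the
integration in (1.17). [cite: Balaban1984PropagatorsI, (1.17) p.20] -/
abbrev slice (k : ℕ) : Submodule ℝ (Fld (towerM L M k)) := dirSpace (Qk L M k) (AxAll L M k)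

/-- the residual gauge group `N(Q′_k)` on level `k`. [cite: Balaban1984PropagatorsI, (1.22) p.21] -/
abbrev resid (k : ℕ) : Submodule ℝ (Scl (towerM L M k)) := dirSpace (Qsk L M k) ⊤

/-- the fibre directions `{n : Q_kn = 0}` on level `k` — the domain of `∫dA δ(B − Q_kA)` in (1.23).
[cite: Balaban1984PropagatorsI, (1.23) p.21] -/
abbrev fdir (k : ℕ) : Submodule ℝ (Fld (towerM L M k)) := dirSpace (Qk L M k) ⊤

omit [NeZero L] hM in
/-- membership in `N(Q′_k)`. [cite: Balaban1984PropagatorsI, (1.22) p.21] -/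
theorem mem_resid_iff (k : ℕ) (l : Scl (towerM L M k)) : l ∈ resid L M k ↔ Qsk L M k l = 0 := by
  rw [mem_dirSpace_iff]
  exact ⟨fun h => h.1, fun h => ⟨h, Submodule.mem_top⟩⟩

omit [NeZero L] hM in
/-- membership in the fibre directions. [cite: Balaban1984PropagatorsI, (1.23) p.21] -/
theorem mem_fdir_iff (k : ℕ) (n : Fld (towerM L M k)) : n ∈ fdir L M k ↔ Qk L M k n = 0 := by
  rw [mem_dirSpace_iff]
  exact ⟨fun h => h.1, fun h => ⟨h, Submodule.mem_top⟩⟩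

/-- `(m, λ) ↦ m − ∂^{L^k}λ` into the fields of level `k`. [cite: Balaban1984PropagatorsI, (1.23) p.21] -/
def phiFun (k : ℕ) : (↥(slice L M k) × ↥(resid L M k)) →ₗ[ℝ] Fld (towerM L M k) :=
  (slice L M k).subtype ∘ₗ LinearMap.fst ℝ _ _ - Dg L M k ∘ₗ (resid L M k).subtype ∘ₗ LinearMap.snd ℝ _ _

omit hM in
/-- its values. [cite: Balaban1984PropagatorsI, (1.23) p.21] -/
theorem phiFun_apply (k : ℕ) (p : ↥(slice L M k) × ↥(resid L M k)) :
    phiFun L M k p = (p.1 : Fld (towerM L M k)) - Dg L M k (p.2 : Scl (towerM L M k)) := rfl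

/-- `m − ∂^{L^k}λ` is a fibre direction: `Q_k(m − ∂λ) = Q_km − Q_k∂λ = 0` ((1.20) iterated).
[cite: Balaban1984PropagatorsI, (1.23) p.21] -/
theorem phiFun_mem (k : ℕ) (p : ↥(slice L M k) × ↥(resid L M k)) : phiFun L M k p ∈ fdir L M k := by
  rw [mem_fdir_iff, phiFun_apply, map_sub, ((mem_dirSpace_iff _).mp p.1.2).1,
    Qk_Dg_eq_zero L M k ((mem_resid_iff L M k _).mp p.2.2), sub_zero]

/-- **the slice ⊕ orbit coordinates on level `k`**. [cite: Balaban1984PropagatorsI, (1.23) p.21] -/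
def phi (k : ℕ) : (↥(slice L M k) × ↥(resid L M k)) →ₗ[ℝ] ↥(fdir L M k) :=
  LinearMap.codRestrict (fdir L M k) (phiFun L M k) (phiFun_mem L M k)

/-- values of the coordinates. [cite: Balaban1984PropagatorsI, (1.23) p.21] -/
theorem phi_apply_coe (k : ℕ) (p : ↥(slice L M k) × ↥(resid L M k)) :
    (phi L M k p : Fld (towerM L M k)) = (p.1 : Fld (towerM L M k)) - Dg L M k (p.2 : Scl (towerM L M k)) := rfl

/-- injectivity = UNIQUENESS of the hierarchical gauge (`B5HierGaugeTorus` §5): `m = ∂λ` with `m` in the support and `λ ∈ N(Q′_k)` means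
`0^{−λ} = ∂λ` and `0^{0} = 0` are both in the support, so `−λ = 0`. [cite: Balaban1984PropagatorsI, (1.23) p.21] -/
theorem phi_injective (k : ℕ) : Function.Injective (phi L M k) := by
  rw [← LinearMap.ker_eq_bot, LinearMap.ker_eq_bot']
  rintro ⟨m, l⟩ h
  have h0 : (m : Fld (towerM L M k)) - Dg L M k (l : Scl (towerM L M k)) = 0 := by
    have h' := congrArg Subtype.val h
    rwa [phi_apply_coe] at h'
  have hml : (m : Fld (towerM L M k)) = Dg L M k (l : Scl (towerM L M k)) := sub_eq_zero.mp h0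
  have hlQ : Qsk L M k (l : Scl (towerM L M k)) = 0 := (mem_resid_iff L M k _).mp l.2
  have hg1 : gaugeR L M k 0 (-(l : Scl (towerM L M k))) ∈ AxAll L M k := by
    rw [gaugeR_eq_sub_Dg, map_neg, sub_neg_eq_add, zero_add, ← hml]
    exact ((mem_dirSpace_iff _).mp m.2).2
  have hg0 : gaugeR L M k 0 (0 : Scl (towerM L M k)) ∈ AxAll L M k := by
    rw [gaugeR_eq_sub_Dg, map_zero, sub_zero]
    exact Submodule.zero_mem _
  have hl0 : (l : Scl (towerM L M k)) = 0 := by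
    have h := hierGauge_unique L M k 0 _ _ (by rw [map_neg, hlQ, neg_zero]) hg1 (map_zero _) hg0
    exact neg_eq_zero.mp h
  have hm0 : (m : Fld (towerM L M k)) = 0 := by rw [hml, hl0, map_zero]
  ext1
  · exact Subtype.ext hm0
  · exact Subtype.ext hl0

/-- surjectivity = EXISTENCE of the hierarchical gauge (`B5HierGaugeTorus` §5): `n = n^{λ} − ∂(−λ)` with `n^λ` in the support,
`Q_k n^λ = Q_kn = 0`. [cite: Balaban1984PropagatorsI, (1.23) p.21] -/
theorem phi_surjective (k : ℕ) : Function.Surjective (phi L M k) := by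
  rintro ⟨n, hn⟩
  have hQn : Qk L M k n = 0 := (mem_fdir_iff L M k n).mp hn
  obtain ⟨l, hlQ, hlAx⟩ := hierGauge_exists L M k n
  have hQm : Qk L M k (gaugeR L M k n l) = 0 := by
    rw [gaugeR_eq_sub_Dg, map_sub, hQn, Qk_Dg_eq_zero L M k hlQ, sub_zero]
  refine ⟨(⟨gaugeR L M k n l, (mem_dirSpace_iff _).mpr ⟨hQm, hlAx⟩⟩,
    ⟨-l, (mem_resid_iff L M k _).mpr (by rw [map_neg, hlQ, neg_zero])⟩), ?_⟩
  apply Subtype.ext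
  rw [phi_apply_coe]
  show gaugeR L M k n l - Dg L M k (-l) = n
  rw [gaugeR_eq_sub_Dg, map_neg, sub_neg_eq_add, sub_add_cancel]

/-- the coordinates as a continuous linear equivalence. [cite: Balaban1984PropagatorsI, (1.23) p.21] -/
def coords (k : ℕ) : (↥(slice L M k) × ↥(resid L M k)) ≃L[ℝ] ↥(fdir L M k) :=
  (LinearEquiv.ofBijective (phi L M k) ⟨phi_injective L M k, phi_surjective L M k⟩).toContinuousLinearEquiv

/-- values of the coordinates. [cite: Balaban1984PropagatorsI, (1.23) p.21] -/
theorem coords_apply_coe (k : ℕ) (m : ↥(slice L M k)) (l : ↥(resid L M k)) :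
    (coords L M k (m, l) : Fld (towerM L M k)) = (m : Fld (towerM L M k)) - Dg L M k (l : Scl (towerM L M k)) := by
  rw [coords, LinearEquiv.coe_toContinuousLinearEquiv', LinearEquiv.ofBijective_apply, phi_apply_coe]

end CoordsK

/-! ## §2  The Faddeev–Popov integral (1.22) on level `k` is the Gaussian integral (1.24) over `N(Q′_k)` and is `> 0`;
«Δ is positive definite on N(Q′_k)» (p. 25) for the composite `Q′_k` -/

section FaddeevPopovK

open MeasureTheory
open B5Action121 (divS LapS GradOp gaugeT actionS)
open B5GaussSectC (gaussW ZN Rop)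

variable (L : ℕ) (M : Fin d → ℕ) [NeZero L] [hM : ∀ μ, NeZero (M μ)]

/-- the REAL divergence `∂*A` on level `k` (`η⁻¹ = L^k`). [cite: Balaban1984PropagatorsI, (1.21) p.21] -/
def dvR (k : ℕ) (A : Fld (towerM L M k)) : Scl (towerM L M k) :=
  WithLp.toLp 2 fun x => ∑ μ, (L : ℝ) ^ k * (A (x - unitVec (towerM L M k) μ, μ) - A (x, μ))

/-- `Δ = ∂*∂` on real scalar functions of level `k` (the tree's `LapS` at `c = L^k`, a real matrix).
[cite: Balaban1984PropagatorsI, (1.21) p.21] -/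
def LapR (k : ℕ) : Scl (towerM L M k) →ₗ[ℝ] Scl (towerM L M k) :=
  Matrix.toEuclideanLin (B5RealFields.reM (LapS (towerM L M k) ((L : ℂ) ^ k)))

omit [NeZero L] hM in
/-- `L^k` is real. [folklore] -/
private theorem conj_Lk (k : ℕ) : starRingEnd ℂ ((L : ℂ) ^ k) = (L : ℂ) ^ k := by
  rw [map_pow, map_natCast]

/-- the complex divergence of a real field is its real divergence. [cite: Balaban1984PropagatorsI, (1.21) p.21] -/
theorem divS_cplx (k : ℕ) (A : Fld (towerM L M k)) (x : Tor (towerM L M k)) :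
    divS (towerM L M k) ((L : ℂ) ^ k) (cplx A) x = ((dvR L M k A x : ℝ) : ℂ) := by
  rw [B5Action121.divS_apply, dvR]
  simp only [cplx, map_pow, map_natCast]
  push_cast
  rfl

/-- `LapS·λ = (Δλ : ℂ)` for real `λ`. [cite: Balaban1984PropagatorsI, (1.21) p.21] -/
theorem LapS_cplxS (k : ℕ) (l : Scl (towerM L M k)) (x : Tor (towerM L M k)) :
    (LapS (towerM L M k) ((L : ℂ) ^ k) *ᵥ cplxS l) x = ((LapR L M k l x : ℝ) : ℂ) := by
  have h1 : ((LapR L M k l x : ℝ) : ℂ) =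
      B5RealFields.cplx (B5RealFields.reM (LapS (towerM L M k) ((L : ℂ) ^ k)) *ᵥ WithLp.ofLp l) x := rfl
  rw [h1, (B5RealFields.isReal_LapS (towerM L M k) (conj_Lk L k)).cplx_mulVec]
  rfl

/-- `∂*(A^λ) = ∂*A − Δλ`. [cite: Balaban1984PropagatorsI, (1.21) p.21] -/
theorem divS_gaugeT {N : Fin d → ℕ} [∀ μ, NeZero (N μ)] (c : ℂ) (X : Tor N × Fin d → ℂ) (m : Tor N → ℂ) :
    divS N c (gaugeT N c X m) = divS N c X - LapS N c *ᵥ m := by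
  unfold gaugeT
  rw [← B5Action121.GradOp_conjTranspose_mulVec_eq, ← B5Action121.GradOp_conjTranspose_mulVec_eq,
    Matrix.mulVec_sub, Matrix.mulVec_mulVec, B5Action121.GradOp_conjTranspose_mul_GradOp]

omit hM in
/-- `η^d > 0`. [cite: Balaban1984PropagatorsI, (1.18) p.20] -/
theorem eta_pow_pos (k : ℕ) : 0 < eta L k ^ d :=
  pow_pos (inv_pos.mpr (pow_pos (Nat.cast_pos.mpr (Nat.pos_of_ne_zero (NeZero.ne L))) _)) _

/-- `∂*(A^λ)(x) = ((∂*A)(x) − (Δλ)(x) : ℂ)` on level `k`. [cite: Balaban1984PropagatorsI, (1.21) p.21] -/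
theorem divS_gaugeR (k : ℕ) (A : Fld (towerM L M k)) (l : Scl (towerM L M k)) (x : Tor (towerM L M k)) :
    divS (towerM L M k) ((L : ℂ) ^ k) (cplx (gaugeR L M k A l)) x = ((dvR L M k A x - LapR L M k l x : ℝ) : ℂ) := by
  rw [cplx_gaugeR, divS_gaugeT, Pi.sub_apply, divS_cplx, LapS_cplxS]
  push_cast
  ring

/-- **«⟨∂*A^λ, ∂*A^λ⟩ = η^d‖∂*A − Δλ‖²»** on level `k`. [cite: Balaban1984PropagatorsI, (1.21) p.21] -/
theorem divSq_gaugeR (k : ℕ) (A : Fld (towerM L M k)) (l : Scl (towerM L M k)) :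
    divSq L M k (gaugeR L M k A l) = eta L k ^ d * ‖dvR L M k A - LapR L M k l‖ ^ 2 := by
  unfold divSq
  rw [← Finset.mul_sum, PiLp.norm_sq_eq_of_L2]
  congr 1
  refine Finset.sum_congr rfl fun x _ => ?_
  rw [divS_gaugeR, Complex.norm_real, PiLp.sub_apply]

/-- the Feynman weight of (1.22) on level `k` is the Gaussian `γ_{α/η^d}(∂*A − Δλ)`. [cite: Balaban1984PropagatorsI, (1.22) p.21] -/
theorem feynman_eq_gaussW (k : ℕ) (α : ℝ) (A : Fld (towerM L M k)) (l : Scl (towerM L M k)) :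
    Real.exp (-(1 / (2 * α)) * divSq L M k (gaugeR L M k A l)) =
      gaussW (Scl (towerM L M k)) (α / eta L k ^ d) (dvR L M k A - LapR L M k l) := by
  rw [divSq_gaugeR, gaussW]
  congr 1
  have h := (eta_pow_pos (d := d) L k).ne'
  field_simp

omit [NeZero L] hM in
/-- `0 ∈ {Q′_kλ = 0}` over `0`. [cite: Balaban1984PropagatorsI, (1.22) p.21] -/
theorem zero_mem_fibre_resid (k : ℕ) : (0 : Scl (towerM L M k)) ∈ fibre (Qsk L M k) ⊤ (0 : Scl M) :=
  ⟨map_zero _, Submodule.mem_top⟩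

/-- (1.22)'s integral on level `k` as an orbit integral over `N(Q′_k)`. [cite: Balaban1984PropagatorsI, (1.22) p.21] -/
theorem fp22_eq_orbit (k : ℕ) (α : ℝ) (A : Fld (towerM L M k)) :
    fp22 L M k α A = ∫ l : ↥(resid L M k),
      Real.exp (-(1 / (2 * α)) * divSq L M k (A - Dg L M k (l : Scl (towerM L M k)))) := by
  unfold fp22
  rw [deltaInt_eq _ (zero_mem_fibre_resid L M k)]
  refine integral_congr_ae (ae_of_all _ fun l => ?_)
  simp only [zero_add, gaugeR_eq_sub_Dg]

/-- (1.22)'s integral on level `k` as the Gaussian integral (1.24). [cite: Balaban1984PropagatorsI, (1.24) p.21] -/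
theorem fp22_eq_gauss (k : ℕ) (α : ℝ) (A : Fld (towerM L M k)) :
    fp22 L M k α A = ∫ l : ↥(resid L M k), gaussW (Scl (towerM L M k)) (α / eta L k ^ d)
      (dvR L M k A - LapR L M k (l : Scl (towerM L M k))) := by
  unfold fp22
  rw [deltaInt_eq _ (zero_mem_fibre_resid L M k)]
  refine integral_congr_ae (ae_of_all _ fun l => ?_)
  simp only [zero_add, feynman_eq_gaussW]

omit hM in
/-- `Q′_k` of a constant is that constant. [cite: Balaban1984PropagatorsI, Sect. C p.22] -/
theorem Qsk_constScl : ∀ (k : ℕ) (a : ℝ), Qsk L M k (constScl (towerM L M k) a) = constScl M a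
  | 0, _ => rfl
  | k + 1, a => by
    show Qsk L M k (QsLin L (towerM L M k) (constScl (towerM L M (k + 1)) a)) = constScl M a
    have h : QsLin L (towerM L M k) (constScl (towerM L M (k + 1)) a) = constScl (towerM L M k) a :=
      QsLin_constScl L (towerM L M k) a
    rw [h]
    exact Qsk_constScl k a

/-- **«the operator Δ is positive definite on N(Q′_k), thus invertible»** (p. 25) for the composite `Q′_k` of the tower:
`Q′_kλ = 0 ∧ Δλ = 0 ⟹ λ = 0` (`Δλ = 0` forces `λ` constant by the tree's `B5LaplaceSpectral.LapS_ker_const`, and `Q′_k`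
of a constant is that constant). [cite: Balaban1984PropagatorsI, p.25] -/
theorem injOn_LapR_resid (k : ℕ) : Set.InjOn (LapR L M k) (resid L M k) := by
  rw [B5GaussSectC.injOn_iff]
  intro x hx hΔ
  have hc : ((L : ℂ) ^ k) ≠ 0 := pow_ne_zero _ (Nat.cast_ne_zero.mpr (NeZero.ne L))
  have hL : LapS (towerM L M k) ((L : ℂ) ^ k) *ᵥ cplxS x = 0 := by
    funext y
    rw [LapS_cplxS, hΔ]
    simp
  have hconst : ∀ y, x y = x 0 := fun y => by
    have h := B5LaplaceSpectral.LapS_ker_const (towerM L M k) hc (cplxS x) hL y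
    simpa [cplxS] using h
  have hxc : x = constScl (towerM L M k) (x 0) := by
    ext y
    exact hconst y
  have hQ : Qsk L M k x = 0 := (mem_resid_iff L M k x).mp hx
  rw [hxc, Qsk_constScl] at hQ
  have h0 : x 0 = 0 := by
    have h := congrArg (fun f : Scl M => f 0) hQ
    simpa [constScl] using h
  rw [hxc, h0]
  ext y
  simp [constScl]

/-- **(1.24) on level `k`**. [cite: Balaban1984PropagatorsI, (1.24) p.21] -/
theorem fp22_eq_124 (k : ℕ) (α : ℝ) (A : Fld (towerM L M k)) :
    fp22 L M k α A = ZN (resid L M k) (LapR L M k) (α / eta L k ^ d) *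
      gaussW (Scl (towerM L M k)) (α / eta L k ^ d)
        (dvR L M k A - Rop (resid L M k) (LapR L M k) (dvR L M k A)) := by
  rw [fp22_eq_gauss]
  exact B5GaussSectC.integral_124 (N := resid L M k) (Δ := LapR L M k) _ _

/-- **(1.22) on level `k`, DISCHARGED**: the Faddeev–Popov integral is `> 0`. [cite: Balaban1984PropagatorsI, (1.22) p.21] -/
theorem fp22_pos (k : ℕ) {α : ℝ} (hα : 0 < α) (A : Fld (towerM L M k)) : 0 < fp22 L M k α A := by
  rw [fp22_eq_124]
  exact mul_pos (B5GaussSectC.ZN_pos (injOn_LapR_resid L M k) (div_pos hα (eta_pow_pos L k)))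
    (B5GaussSectC.gaussW_pos _ _)

/-- **`Claim122 L M k α` for every level `k` and every `α > 0`.** [cite: Balaban1984PropagatorsI, (1.22) p.21] -/
theorem claim122 (k : ℕ) {α : ℝ} (hα : 0 < α) : Claim122 L M k α :=
  fun A => (fp22_pos L M k hα A).ne'

end FaddeevPopovK

/-! ## §3  (1.23) on every level `k`: `rt17 k = c·rt23 k α`, and `Eq123 L M k` from `Eq117 L M k` -/

section ChangeOfGaugeK

open MeasureTheory
open B5Action121 (divS actionS Fs)

variable (L : ℕ) (M : Fin d → ℕ) [NeZero L] [hM : ∀ μ, NeZero (M μ)]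

/-- the coordinates of a real field depend continuously on it. [folklore] -/
private theorem continuous_apply_fld {N : Fin d → ℕ} [∀ μ, NeZero (N μ)] (i : Tor N × Fin d) :
    Continuous fun A : Fld N => A i :=
  PiLp.continuous_apply 2 _ i

/-- `A ↦ ⟨∂*A, ∂*A⟩` is continuous (a polynomial in the coordinates). [cite: Balaban1984PropagatorsI, (1.21) p.21] -/
theorem continuous_divSq (k : ℕ) : Continuous (divSq L M k) := by
  unfold divSq
  refine continuous_finsetSum _ fun x _ => continuous_const.mul ((Continuous.norm ?_).pow 2)
  simp only [B5Action121.divS_apply, cplx]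
  refine continuous_finsetSum _ fun μ _ => continuous_const.mul (Continuous.sub ?_ ?_) <;>
    exact Complex.continuous_ofReal.comp (continuous_apply_fld _)

/-- `A ↦ S^η(A)` is continuous (a polynomial in the coordinates). [cite: Balaban1984PropagatorsI, (1.3) p.18] -/
theorem continuous_actionEta (k : ℕ) : Continuous (actionEta L M k) := by
  unfold actionEta actionS
  refine continuous_const.mul (continuous_finsetSum _ fun x _ => continuous_finsetSum _ fun μ _ =>
    continuous_finsetSum _ fun ν _ => ?_)
  refine continuous_if_const _ (fun _ => continuous_const.mul ((Continuous.norm ?_).pow 2)) fun _ => continuous_const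
  simp only [B5Action121.Fs_apply, cplx]
  refine continuous_const.mul (((Continuous.add ?_ ?_).sub ?_).sub ?_) <;>
    exact Complex.continuous_ofReal.comp (continuous_apply_fld _)

/-- the fibre of (1.17) over every `B` is non-empty on every level (iterate the tree's section `secFld`).
[cite: Balaban1984PropagatorsI, (1.17) p.20] -/
theorem fibre_slice_nonempty : ∀ (k : ℕ) (B : Fld M), (fibre (Qk L M k) (AxAll L M k) B).Nonempty
  | 0, B => ⟨B, rfl, Submodule.mem_top⟩
  | k + 1, B => by
    obtain ⟨A', hQ, hAx⟩ := fibre_slice_nonempty k B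
    refine ⟨secFld L (towerM L M k) A', ?_, (mem_axAll_succ_iff L M k _).mpr ⟨secFld_mem_Ax L _ A', ?_⟩⟩
    · show Qk L M k (Qlin L (towerM L M k) (secFld L (towerM L M k) A')) = B
      rw [Qlin_secFld, hQ]
    · rw [Qlin_secFld]
      exact hAx

/-- «∫dA δ(B − Q_kA)δ_Ax(Q_{k−1}A)…δ_Ax(A) e^{−S^η(A)}» as the integral over the slice through a point `A₁` of the fibre.
[cite: Balaban1984PropagatorsI, (1.17) p.20] -/
theorem rt17_eq (k : ℕ) {B : Fld M} {A₁ : Fld (towerM L M k)} (hA₁ : A₁ ∈ fibre (Qk L M k) (AxAll L M k) B) :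
    rt17 L M k B = ∫ m : ↥(slice L M k), Real.exp (-actionEta L M k (A₁ + (m : Fld (towerM L M k)))) := by
  unfold rt17
  exact deltaInt_eq _ hA₁

/-- the right-hand side of (1.23) on level `k` as the integral over the fibre directions through `A₁`.
[cite: Balaban1984PropagatorsI, (1.23) p.21] -/
theorem rt23_eq (k : ℕ) (α : ℝ) {B : Fld M} {A₁ : Fld (towerM L M k)} (hA₁ : A₁ ∈ fibre (Qk L M k) (AxAll L M k) B) :
    rt23 L M k α B = ∫ n : ↥(fdir L M k),
      Real.exp (-(1 / (2 * α)) * divSq L M k (A₁ + (n : Fld (towerM L M k)))) *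
        (fp22 L M k α (A₁ + (n : Fld (towerM L M k))))⁻¹ *
          Real.exp (-actionEta L M k (A₁ + (n : Fld (towerM L M k)))) := by
  unfold rt23
  exact deltaInt_eq _ ⟨hA₁.1, Submodule.mem_top⟩

/-- **(1.23) on level `k` — «(1.17) = z′^{(k)}∫dA δ(B − Q_kA) exp(−(1/2α)⟨∂*A,∂*A⟩)(∫dλδ(Q′_kλ)exp(−(1/2α)⟨∂*A^λ,∂*A^λ⟩))^{−1}
e^{−S^η(A)}» for the typed objects of `B5SectBStatements`**: for every `α > 0` ONE constant `c > 0` (the Jacobian of the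
level-`k` coordinates; in the paper `z′^{(k)} = z^{(k)}·c`) with `rt17 k B = c · rt23 k α B` for all `B`.  Proof = the
tree's `B5ChangeOfGauge123.eq123` with the coordinates `coords` (§1 ⟸ the hierarchical gauge of `B5HierGaugeTorus`), gauge invariance of
`S^η` (`actionEta_gaugeR`), and (1.22) on level `k` (§2). [cite: Balaban1984PropagatorsI, (1.23) p.21] -/
theorem rt17_eq_rt23 (k : ℕ) {α : ℝ} (hα : 0 < α) :
    ∃ c : ℝ, 0 < c ∧ ∀ B : Fld M, rt17 L M k B = c * rt23 L M k α B := by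
  haveI : ((volume : Measure ↥(slice L M k)).prod (volume : Measure ↥(resid L M k))).IsAddHaarMeasure :=
    Measure.prod.instIsAddHaarMeasure _ _
  haveI : (((volume : Measure ↥(slice L M k)).prod (volume : Measure ↥(resid L M k))).map
      (coords L M k)).IsAddHaarMeasure := (coords L M k).isAddHaarMeasure_map _
  refine ⟨(Measure.addHaarScalarFactor (((volume : Measure ↥(slice L M k)).prod
      (volume : Measure ↥(resid L M k))).map (coords L M k)) (volume : Measure ↥(fdir L M k)) : ℝ),
    NNReal.coe_pos.mpr (B5ChangeOfGauge123.jacobian_pos _ _ _ (coords L M k)), fun B => ?_⟩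
  obtain ⟨A₁, hA₁⟩ := fibre_slice_nonempty L M k B
  obtain ⟨g, hg⟩ : ∃ g : Fld (towerM L M k) → ℝ, ∀ A, g A = Real.exp (-(1 / (2 * α)) * divSq L M k A) :=
    ⟨fun A => Real.exp (-(1 / (2 * α)) * divSq L M k A), fun _ => rfl⟩
  obtain ⟨ρ, hρ⟩ : ∃ ρ : Fld (towerM L M k) → ℝ, ∀ A, ρ A = Real.exp (-actionEta L M k A) :=
    ⟨fun A => Real.exp (-actionEta L M k A), fun _ => rfl⟩
  obtain ⟨s, hs⟩ : ∃ s : ↥(slice L M k) → Fld (towerM L M k), ∀ m, s m = A₁ + (m : Fld (towerM L M k)) :=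
    ⟨fun m => A₁ + (m : Fld (towerM L M k)), fun _ => rfl⟩
  set D : ↥(resid L M k) →ₗ[ℝ] Fld (towerM L M k) := Dg L M k ∘ₗ (resid L M k).subtype with hD
  have hDl : ∀ l : ↥(resid L M k), D l = Dg L M k (l : Scl (towerM L M k)) := fun l => rfl
  have he : ∀ (m : ↥(slice L M k)) (l : ↥(resid L M k)),
      A₁ + (fdir L M k).subtype (coords L M k (m, l)) = s m - D l := by
    intro m l
    rw [hs, hDl, Submodule.subtype_apply, coords_apply_coe]
    exact (add_sub_assoc _ _ _).symm
  have hg0 : ∀ A, 0 ≤ g A := fun A => by rw [hg]; exact (Real.exp_pos _).le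
  have hρ0 : ∀ A, 0 ≤ ρ A := fun A => by rw [hρ]; exact (Real.exp_pos _).le
  have hgc : Continuous g := by
    rw [show g = fun A => Real.exp (-(1 / (2 * α)) * divSq L M k A) from funext hg]
    exact Real.continuous_exp.comp (continuous_const.mul (continuous_divSq L M k))
  have hρc : Continuous ρ := by
    rw [show ρ = fun A => Real.exp (-actionEta L M k A) from funext hρ]
    exact Real.continuous_exp.comp (continuous_actionEta L M k).neg
  have hsc : Continuous s := by
    rw [show s = fun m : ↥(slice L M k) => A₁ + (m : Fld (towerM L M k)) from funext hs]
    exact continuous_const.add continuous_subtype_val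
  have hgm : AEStronglyMeasurable (fun p : ↥(slice L M k) × ↥(resid L M k) => g (s p.1 - D p.2))
      ((volume : Measure ↥(slice L M k)).prod (volume : Measure ↥(resid L M k))) :=
    (hgc.comp ((hsc.comp continuous_fst).sub (D.continuous_of_finiteDimensional.comp continuous_snd))).aestronglyMeasurable
  have hρm : AEStronglyMeasurable (fun m => ρ (s m)) (volume : Measure ↥(slice L M k)) :=
    (hρc.comp hsc).aestronglyMeasurable
  have hρinv : ∀ (m : ↥(slice L M k)) (l : ↥(resid L M k)), ρ (s m - D l) = ρ (s m) := by
    intro m l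
    rw [hρ, hρ, hDl, ← gaugeR_eq_sub_Dg, actionEta_gaugeR]
  have hZ : ∀ m : ↥(slice L M k), ∫ l, g (s m - D l) ∂(volume : Measure ↥(resid L M k)) ≠ 0 := by
    intro m
    simp only [hg, hDl]
    rw [← fp22_eq_orbit]
    exact (fp22_pos L M k hα _).ne'
  have h := B5ChangeOfGauge123.eq123 (volume : Measure ↥(slice L M k)) (volume : Measure ↥(resid L M k))
    (volume : Measure ↥(fdir L M k)) (coords L M k) A₁ (fdir L M k).subtype s D he g ρ hg0 hρ0 hgm hρm hρinv hZ 1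
  rw [one_mul, one_mul] at h
  rw [rt17_eq L M k hA₁, rt23_eq L M k α hA₁]
  simp only [hg, hρ, hs, hDl, Submodule.subtype_apply, ← fp22_eq_orbit] at h
  exact h

/-- **`Eq123 L M k` from `Eq117 L M k`, every level `k`**: (1.23) for the k-fold transformation `(ST)^k e^{−S}` given
(1.17) on level `k` (r02's `eq117_holds`, companion `B5Eq114Gauss`; bookkeeping `B5SectBStatements.eq123_of_eq117`).
[cite: Balaban1984PropagatorsI, (1.23) p.21] -/
theorem eq123_holds_of_eq117 (k : ℕ) (h117 : Eq117 L M k) : Eq123 L M k :=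
  eq123_of_eq117 L M k h117 fun _ hα => rt17_eq_rt23 L M k hα


/-- **`Claim122 L M 1 α`** (the first level, as announced for this seat). [cite: Balaban1984PropagatorsI, (1.22) p.21] -/
theorem claim122_one {α : ℝ} (hα : 0 < α) : Claim122 L M 1 α :=
  claim122 L M 1 hα

/-- **(1.23) PROVED on every level `k`** for `d ≥ 2` (every `L ≥ 1`, every torus, every `α > 0`): `((ST)^k e^{−S})(B) =
z′^{(k)}∫dA δ(B − Q_kA) exp(−(1/2α)⟨∂*A,∂*A⟩)(∫dλ δ(Q′_kλ) exp(−(1/2α)⟨∂*A^λ,∂*A^λ⟩))^{−1} e^{−S^η(A)}` with a constant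
`z′^{(k)} > 0` — `eq123_holds_of_eq117` fed with the B5 owner's (1.17) `B5Eq114Gauss.eq117_holds`.
[cite: Balaban1984PropagatorsI, (1.23) p.21] -/
theorem eq123_holds (hd : 2 ≤ d) (k : ℕ) : Eq123 L M k :=
  eq123_holds_of_eq117 L M k (B5Eq114Gauss.eq117_holds L M hd k)

/-- **`Eq123 L M 1`**, unconditionally (the first level; (1.17) at `k = 1` is `B5Eq114Gauss.eq117_one`, any `d`).
[cite: Balaban1984PropagatorsI, (1.23) p.21] -/
theorem eq123_one : Eq123 L M 1 :=
  eq123_holds_of_eq117 L M 1 (B5Eq114Gauss.eq117_one L M)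

end ChangeOfGaugeK

end

end Literature.MathematicalPhysics.QuantumFieldTheory.Balaban1983to89.B5Eq123Torus
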